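import Literature.Geometry.Lorentzian.KerrSeparatedPotentialBounds
import Literature.Geometry.Lorentzian.KerrFrequencyRanges
import HarnessLib

/-!
# The near-horizon region `V ≤ ω² − bΛ` of the trapping range `𝓖_♮`
# (Dafermos–Rodnianski–Shlapentokh-Rothman, Lemma 8.6.1, first assertion)

(family `gr`, infrastructure for statement **gr.S24**; namespace `Literature.Geometry.Lorentzian.Kerr`)

Dafermos–Rodnianski–Shlapentokh-Rothman (*Decay for solutions of the wave equation on Kerr exterior
spacetimes III*, arXiv:1402.7034 = Ann. of Math. 183 (2016)), Lemma 8.6.1, first assertion: for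
`ε_width > 0`, all `ω_high` sufficiently large depending on `ε_width` and
`(ω, m, Λ) ∈ 𝓖_♮(ω_high, ε_width)` (admissible, `|ω| ≥ ω_high`, `ε_width Λ ≤ ω² ≤ ε_width⁻¹Λ`, off the
near-superradiant strip) "there exists an `r₃ ∈ (r₊, ∞]` depending on the frequency triple but
bounded away from `r₊`, `r₃ − r₊ ≥ b(ε_width)`, such that for `r ∈ [r₊, r₃]`,
`V(r) ≤ ω² − b(ε_width)Λ`". Its proof starts from
`ω² − V(r₊) = ω² − V₀(r₊) ≥ cΛ`, `c = c(ε_width)` (off the strip;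
`KerrFrequencyRanges.min_mul_le_sq_sub_sepPotential₀_rPlus`, `c = min(ε_width, α²)` for the repaired
strip) and the bound `|dV₀/dr| ≤ B(ε_width)Λr⁻³`, and adds `V₁` "requiring that `ω_high` is
sufficiently large"; the maximal such `r₃` and the structure of `V` on `[r₃, ∞)` (the remaining
assertions of the lemma) involve the case analysis of its proof and are not treated here.

This file **proves** the first assertion with the minimal admissible choice `r₃ = r₊ + d`, explicitly:

* `sepPotential_le_sq_sub_near_horizon`: for `0 < M`, `|a| ≤ M`, `c > 0`, an admissible triple with
  `ω² − V₀(r₊) ≥ cΛ` and `Λ ≥ 12/(cM²)`: `V(r) ≤ ω² − (c/2)Λ` for all `r ∈ [r₊, r₊ + cM³/96]`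
  (`|V₀(r) − V₀(r₊)| ≤ (24Λ/M³)(r − r₊) ≤ cΛ/4` by `|dV₀/dr| ≤ 24Λ/r³`,
  `KerrSeparatedPotentialBounds.abs_deriv_sepPotential₀_le`, and `0 ≤ V₁ ≤ 3M/r³ ≤ 3/M² ≤ cΛ/4`,
  `KerrSeparatedPotentialBounds.sepPotential₁_le`);
* `sepPotential_le_sq_sub_of_isFreqNatural'`: hence for `0 < α`, `0 < ε` there is `ω₀` such that for
  all `ω_high ≥ ω₀` and `(ω, m, Λ) ∈ 𝓖_♮(ω_high, ε)` (`IsFreqNatural` with the repaired strip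
  `IsNearSuperradiant' M a α`): `V(r) ≤ ω² − (min(ε, α²)/2)Λ` on `[r₊, r₊ + min(ε, α²)M³/96]`
  (`Λ ≥ εω² ≥ εω²_high ≥ 12/(min(ε, α²)M²)`).

## References

* M. Dafermos, I. Rodnianski, Y. Shlapentokh-Rothman, arXiv:1402.7034 = Ann. of Math. 183
  (2016), §8.6, Lemma 8.6.1 (first assertion) and the first paragraph of its proof
  (key `DafermosRodnianskiShlapentokhrothman2014`).
-/

noncomputable section

open Set

namespace Literature.Geometry.Lorentzian

namespace Kerr

/-- **Lemma 8.6.1, first assertion, explicit form.** For `0 < M`, `|a| ≤ M`, a constant `c > 0` and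
an admissible triple with `ω² − V₀(r₊) ≥ cΛ` and `Λ ≥ 12/(cM²)`: `V(r) ≤ ω² − (c/2)Λ` for every
`r ∈ [r₊, r₊ + cM³/96]` — "`V(r) ≤ ω² − b(ε_width)Λ` for `r ∈ [r₊, r₃]`, `r₃ − r₊ ≥ b(ε_width)`"
(DRSR arXiv:1402.7034, Lemma 8.6.1), with `r₃ − r₊ = cM³/96` and `b = c/2`; in loc. cit.
`c = c(ε_width)` comes from the first display of the proof (`min_mul_le_sq_sub_sepPotential₀_rPlus`)
and the largeness of `Λ` from "`ω_high` sufficiently large depending on `ε_width`".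
[cite: DafermosRodnianskiShlapentokhrothman2014, Lemma 8.6.1] -/
theorem sepPotential_le_sq_sub_near_horizon {M a ω Λ c : ℝ} {m : ℤ} (hM : 0 < M) (haM : |a| ≤ M)
    (hc : 0 < c) (hadm : IsAdmissibleTriple a ω m Λ)
    (hcΛ : c * Λ ≤ ω ^ 2 - sepPotential₀ M a ω m Λ (rPlus M a)) (hΛ : 12 / (c * M ^ 2) ≤ Λ)
    {r : ℝ} (hr : r ∈ Icc (rPlus M a) (rPlus M a + c * M ^ 3 / 96)) :
    sepPotential M a ω m Λ r ≤ ω ^ 2 - c / 2 * Λ := by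
  have hΛ0 : 0 ≤ Λ := hadm.nonneg
  have hrpM : M ≤ rPlus M a := M_le_rPlus M a
  have hrp0 : 0 < rPlus M a := hM.trans_le hrpM
  have hrM : M ≤ r := hrpM.trans hr.1
  have hr0 : 0 < r := hM.trans_le hrM
  -- `|V₀(r) − V₀(r₊)| ≤ (24Λ/M³)(r − r₊)`
  have hlip : ‖sepPotential₀ M a ω m Λ r - sepPotential₀ M a ω m Λ (rPlus M a)‖ ≤
      24 * Λ / M ^ 3 * ‖r - rPlus M a‖ := by
    refine Convex.norm_image_sub_le_of_norm_deriv_le (fun z hz ↦ ?_) (fun z hz ↦ ?_)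
      (convex_Ici (rPlus M a)) (self_mem_Ici) hr.1
    · have hz0 : (0 : ℝ) < z := hrp0.trans_le hz
      exact (hasDerivAt_sepPotential₀_critPoly M a ω m Λ
        (by positivity : z ^ 2 + a ^ 2 ≠ 0)).differentiableAt
    · have hzM : M ≤ z := hrpM.trans hz
      have hz0 : 0 < z := hM.trans_le hzM
      rw [Real.norm_eq_abs]
      refine (abs_deriv_sepPotential₀_le hM haM hadm hzM).trans ?_
      apply div_le_div_of_nonneg_left (by positivity) (by positivity)
      exact pow_le_pow_left₀ hM.le hzM 3
  rw [Real.norm_eq_abs, Real.norm_eq_abs, abs_of_nonneg (sub_nonneg.2 hr.1)] at hlip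
  have h1 : 24 * Λ / M ^ 3 * (r - rPlus M a) ≤ c / 4 * Λ := by
    have hd : r - rPlus M a ≤ c * M ^ 3 / 96 := by linarith only [hr.2]
    calc 24 * Λ / M ^ 3 * (r - rPlus M a) ≤ 24 * Λ / M ^ 3 * (c * M ^ 3 / 96) := by gcongr
      _ = c / 4 * Λ := by field_simp; ring
  have h2 : sepPotential₀ M a ω m Λ r ≤ sepPotential₀ M a ω m Λ (rPlus M a) + c / 4 * Λ := by
    linarith only [hlip, h1,
      le_abs_self (sepPotential₀ M a ω m Λ r - sepPotential₀ M a ω m Λ (rPlus M a))]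
  -- `V₁(r) ≤ 3M/r³ ≤ 3/M² ≤ (c/4)Λ`
  have h3 : sepPotential₁ M a r ≤ c / 4 * Λ := by
    have hV1 := sepPotential₁_le hM haM hr.1
    have hM3 : 3 * M / r ^ 3 ≤ 3 * M / M ^ 3 := by
      apply div_le_div_of_nonneg_left (by positivity) (by positivity)
      exact pow_le_pow_left₀ hM.le hrM 3
    have hM3' : 3 * M / M ^ 3 = 3 / M ^ 2 := by field_simp
    have hcΛ' : 3 / M ^ 2 ≤ c / 4 * Λ := by
      rw [div_le_iff₀ (by positivity)] at hΛ
      rw [div_le_iff₀ (by positivity)]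
      linarith only [hΛ]
    linarith only [hV1, hM3, hM3'.le, hcΛ']
  unfold sepPotential
  linarith only [h2, h3, hcΛ]

/-- **Lemma 8.6.1, first assertion, for the range `𝓖_♮(ω_high, ε)` (repaired strip).** For
`0 < M`, `0 ≤ a ≤ M`, `0 < α`, `0 < ε` there is `ω₀` such that for all `ω_high ≥ ω₀` and all
`(ω, m, Λ) ∈ 𝓖_♮(ω_high, ε)` (`IsFreqNatural` with the strip `IsNearSuperradiant' M a α`: admissible,
`ω_high ≤ |ω|`, `εΛ ≤ ω² ≤ ε⁻¹Λ`, off the strip): `V(r) ≤ ω² − (min(ε, α²)/2)Λ` for all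
`r ∈ [r₊, r₊ + min(ε, α²)M³/96]` (so `r₃ − r₊ ≥ b(ε)` and `V ≤ ω² − b(ε)Λ` on `[r₊, r₃]` with
`b(ε) = min(min(ε, α²)/2, min(ε, α²)M³/96)`). Here `ω₀ = √(12/(ε min(ε, α²)M²))`: membership gives
`Λ ≥ εω² ≥ εω²_high ≥ 12/(min(ε, α²)M²)`. DRSR arXiv:1402.7034, Lemma 8.6.1 ("for all `ω_high`
sufficiently large depending on `ε_width`"). [cite: DafermosRodnianskiShlapentokhrothman2014, Lemma 8.6.1] -/
theorem sepPotential_le_sq_sub_of_isFreqNatural' {M a α ε : ℝ} (hM : 0 < M) (ha0 : 0 ≤ a)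
    (haM : a ≤ M) (hα : 0 < α) (hε : 0 < ε) :
    ∃ ω₀ : ℝ, ∀ ωh : ℝ, ω₀ ≤ ωh → ∀ (ω : ℝ) (m : ℤ) (Λ : ℝ),
      IsFreqNatural (IsNearSuperradiant' M a α) a ωh ε ω m Λ →
      ∀ r ∈ Icc (rPlus M a) (rPlus M a + min ε (α ^ 2) * M ^ 3 / 96),
        sepPotential M a ω m Λ r ≤ ω ^ 2 - min ε (α ^ 2) / 2 * Λ := by
  have haM' : |a| ≤ M := by rwa [abs_of_nonneg ha0]
  have hc : 0 < min ε (α ^ 2) := lt_min hε (by positivity)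
  refine ⟨√(12 / (ε * min ε (α ^ 2) * M ^ 2)), fun ωh hωh ω m Λ hG r hr ↦ ?_⟩
  obtain ⟨hadm, hωh', hεΛ, hω2, hS⟩ := hG
  have hω0 : 0 ≤ √(12 / (ε * min ε (α ^ 2) * M ^ 2)) := Real.sqrt_nonneg _
  have hωh0 : 0 ≤ ωh := hω0.trans hωh
  -- `Λ ≥ εω² ≥ εω²_high ≥ 12/(min(ε, α²)M²)`
  have hΛ : 12 / (min ε (α ^ 2) * M ^ 2) ≤ Λ := by
    have h1 : 12 / (ε * min ε (α ^ 2) * M ^ 2) ≤ ωh ^ 2 := by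
      calc 12 / (ε * min ε (α ^ 2) * M ^ 2) = (√(12 / (ε * min ε (α ^ 2) * M ^ 2))) ^ 2 :=
            (Real.sq_sqrt (by positivity)).symm
        _ ≤ ωh ^ 2 := pow_le_pow_left₀ hω0 hωh 2
    have h2 : ωh ^ 2 ≤ ω ^ 2 := by
      calc ωh ^ 2 ≤ |ω| ^ 2 := pow_le_pow_left₀ hωh0 hωh' 2
        _ = ω ^ 2 := sq_abs ω
    have h3 : ω ^ 2 ≤ ε⁻¹ * Λ := hω2
    have h4 : ε * ω ^ 2 ≤ Λ := by
      have := mul_le_mul_of_nonneg_left h3 hε.le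
      rwa [← mul_assoc, mul_inv_cancel₀ hε.ne', one_mul] at this
    have h5 : 12 / (min ε (α ^ 2) * M ^ 2) = ε * (12 / (ε * min ε (α ^ 2) * M ^ 2)) := by
      field_simp
    rw [h5]
    calc ε * (12 / (ε * min ε (α ^ 2) * M ^ 2)) ≤ ε * ωh ^ 2 :=
          mul_le_mul_of_nonneg_left h1 hε.le
      _ ≤ ε * ω ^ 2 := mul_le_mul_of_nonneg_left h2 hε.le
      _ ≤ Λ := h4
  have hcΛ := min_mul_le_sq_sub_sepPotential₀_rPlus hM ha0 haM hα.le hadm hS hεΛ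
  exact sepPotential_le_sq_sub_near_horizon hM haM' hc hadm hcΛ hΛ hr

end Kerr

end Literature.Geometry.Lorentzian

end
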